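import Summits.KontsevichZagierPeriods.KontsevichZagierPeriods.Theses.HurwitzMicroSectors

/-!
# `ReductionTwoSix` (stmt-KontsevichZagierPeriods-3871) — negative side II: the soundness channel (kit)

Refuter (`cdisprove`) infrastructure, kernel-checked. Evaluation (`KZ.Equivalent.value_eq_holds`) is
the only invariant of `KZ.relations` in the tree, so every refutation of the crux or of a variant goes
through values. The route's standing hypotheses are abstracted as `RigidityInput I₁ I₂`
(`1/(1−xy)` and `1/(1+xy+x²y²)` integrable on the open box with integrals `I₁, I₂`, and `1, I₁, I₂`
ℚ-linearly independent); items BoxIntegralZetaTwo, BoxIntegralLTwoChiThree and CDT 2024 Thm 1 supply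
them with `I₁ = π²/6`, `I₂ = L(2,χ₋₃)` (`rigidityInput_of_route`). Contents: the box and its
elementary facts, the normal-form integrand `nf a b c` and representation `nfRep`, `value_of_nf`
(`value = a + b I₁ + c I₂`), `coeff_unique` / `coeff_eq_of_equivalent` (rigidity by soundness).
Used by `Negative.Tightness` and `Negative.NonVacuity`.
[Kontsevich–Zagier 2001 §1.1–1.2; Calegari–Dimitrov–Tang 2024 Thm 1, Cor. 2]
-/

namespace Summit.KontsevichZagierPeriods.HurwitzMicroSectors.ReductionTwoSixNegative

open MeasureTheory Set
open Literature.NumberTheory.Transcendental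
open Summit.KontsevichZagierPeriods.KontsevichZagierPeriods.Theses.HurwitzMicroSectors

noncomputable section

/-! ## §2 The soundness channel: rigidity inputs, normal-form representations, values -/

/-- The open unit box `(0,1)²`, literally as in the crux. -/
def box : Set (Fin 2 → ℝ) := {x | ∀ i, x i ∈ Set.Ioo (0:ℝ) 1}

/-- Auxiliary: `box_eq_pi`. [folklore] -/
theorem box_eq_pi : box = Set.pi Set.univ (fun _ : Fin 2 => Set.Ioo (0:ℝ) 1) := by
  ext x; simp [box, Set.mem_pi]

/-- Auxiliary: `measurableSet_box`. [folklore] -/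
theorem measurableSet_box : MeasurableSet box := by
  rw [box_eq_pi]; exact MeasurableSet.univ_pi fun _ => measurableSet_Ioo

/-- Auxiliary: `volume_box_toReal`. [folklore] -/
theorem volume_box_toReal : (volume box).toReal = 1 := by
  rw [box_eq_pi, Real.volume_pi_Ioo_toReal (fun _ => zero_le_one)]
  simp

/-- Auxiliary: `volume_box_ne_top`. [folklore] -/
theorem volume_box_ne_top : volume box ≠ ⊤ := by
  rw [box_eq_pi, Real.volume_pi_Ioo]
  simp

/-- Auxiliary: `volume_real_box`. [folklore] -/
theorem volume_real_box : volume.real box = 1 := by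
  rw [measureReal_def, volume_box_toReal]

/-- The open unit box is `ℚ`-semialgebraic (four strict polynomial inequalities). -/
theorem isSemialgebraic_box :
    Literature.ModelTheory.ExponentialFields.IsSemialgebraic ℚ box := by
  have h : box =
      ⋂ j ∈ (Finset.univ : Finset (Fin 2)),
        ({x | 0 < MvPolynomial.aeval x (MvPolynomial.X j : MvPolynomial (Fin 2) ℚ)} ∩
          {x | 0 < MvPolynomial.aeval x (1 - MvPolynomial.X j : MvPolynomial (Fin 2) ℚ)}) := by
    ext x
    simp [box, sub_pos]
  rw [h]
  exact Literature.ModelTheory.ExponentialFields.IsSemialgebraic.biInter _ _ fun j _ =>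
    (Literature.ModelTheory.ExponentialFields.isSemialgebraic_setOf_eval_pos _).inter
      (Literature.ModelTheory.ExponentialFields.isSemialgebraic_setOf_eval_pos _)

/-- Auxiliary: `t_pos`. [folklore] -/
theorem t_pos {x : Fin 2 → ℝ} (hx : x ∈ box) : 0 < x 0 * x 1 :=
  mul_pos (hx 0).1 (hx 1).1

/-- Auxiliary: `t_lt_one`. [folklore] -/
theorem t_lt_one {x : Fin 2 → ℝ} (hx : x ∈ box) : x 0 * x 1 < 1 :=
  mul_lt_one_of_nonneg_of_lt_one_left (hx 0).1.le (hx 0).2 (hx 1).2.le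

/-- Auxiliary: `one_sub_t_ne`. [folklore] -/
theorem one_sub_t_ne {x : Fin 2 → ℝ} (hx : x ∈ box) : 1 - x 0 * x 1 ≠ 0 :=
  (sub_pos.mpr (t_lt_one hx)).ne'

/-- Auxiliary: `one_sub_t6_ne`. [folklore] -/
theorem one_sub_t6_ne {x : Fin 2 → ℝ} (hx : x ∈ box) : 1 - (x 0 * x 1) ^ 6 ≠ 0 :=
  (sub_pos.mpr (pow_lt_one₀ (t_pos hx).le (t_lt_one hx) (by norm_num))).ne'

/-- Auxiliary: `cubic_ne`. [folklore] -/
theorem cubic_ne {x : Fin 2 → ℝ} (hx : x ∈ box) : 1 + x 0 * x 1 + (x 0 * x 1) ^ 2 ≠ 0 := by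
  have := t_pos hx; positivity

/-- The normal-form integrand, literally as in the crux. -/
def nf (a b c : ℚ) : (Fin 2 → ℝ) → ℝ :=
  fun x => (a : ℝ) + b / (1 - x 0 * x 1) + c / (1 + x 0 * x 1 + (x 0 * x 1) ^ 2)

/-- RIGIDITY INPUTS (the route's own standing hypotheses, abstracted): the two basis integrands are
integrable on the box with integrals `I₁`, `I₂`, and `1, I₁, I₂` are `ℚ`-linearly independent.
The route instantiates `I₁ = π²/6` (`BoxIntegralZetaTwo`), `I₂ = L(2,χ₋₃)`
(`BoxIntegralLTwoChiThree`) and CDT 2024 Thm 1 (`rigidityInput_of_route`). -/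
structure RigidityInput (I₁ I₂ : ℝ) : Prop where
  int₁ : IntegrableOn (fun x : Fin 2 → ℝ => 1 / (1 - x 0 * x 1)) box
  val₁ : ∫ x in box, 1 / (1 - x 0 * x 1) = I₁
  int₂ : IntegrableOn (fun x : Fin 2 → ℝ => 1 / (1 + x 0 * x 1 + (x 0 * x 1) ^ 2)) box
  val₂ : ∫ x in box, 1 / (1 + x 0 * x 1 + (x 0 * x 1) ^ 2) = I₂
  indep : LinearIndependent ℚ ![(1 : ℝ), I₁, I₂]

variable {I₁ I₂ : ℝ}

/-- Auxiliary: `nf_eq_mul`. [folklore] -/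
theorem nf_eq_mul (a b c : ℚ) : nf a b c = fun x : Fin 2 → ℝ =>
    (a : ℝ) + (b : ℝ) * (1 / (1 - x 0 * x 1)) + (c : ℝ) * (1 / (1 + x 0 * x 1 + (x 0 * x 1) ^ 2)) := by
  funext x; simp only [nf]; ring

/-- Auxiliary: `integrableOn_nf`. [folklore] -/
theorem integrableOn_nf (h : RigidityInput I₁ I₂) (a b c : ℚ) : IntegrableOn (nf a b c) box := by
  rw [nf_eq_mul]
  have h0 : IntegrableOn (fun _ : Fin 2 → ℝ => (a : ℝ)) box := integrableOn_const volume_box_ne_top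
  exact (h0.add (h.int₁.const_mul (b : ℝ))).add (h.int₂.const_mul (c : ℝ))

/-- The numerator / denominator polynomials exhibiting `nf a b c` as KZ-rational on the box. -/
def nfNum (a b c : ℚ) : MvPolynomial (Fin 2) ℚ :=
  MvPolynomial.C a * (1 - MvPolynomial.X 0 * MvPolynomial.X 1) *
      (1 + MvPolynomial.X 0 * MvPolynomial.X 1 + (MvPolynomial.X 0 * MvPolynomial.X 1) ^ 2) +
    MvPolynomial.C b * (1 + MvPolynomial.X 0 * MvPolynomial.X 1 + (MvPolynomial.X 0 * MvPolynomial.X 1) ^ 2) +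
    MvPolynomial.C c * (1 - MvPolynomial.X 0 * MvPolynomial.X 1)

/-- Auxiliary: `nfDen`. [folklore] -/
def nfDen : MvPolynomial (Fin 2) ℚ :=
  (1 - MvPolynomial.X 0 * MvPolynomial.X 1) *
    (1 + MvPolynomial.X 0 * MvPolynomial.X 1 + (MvPolynomial.X 0 * MvPolynomial.X 1) ^ 2)

/-- Auxiliary: `aeval_nfDen`. [folklore] -/
theorem aeval_nfDen (x : Fin 2 → ℝ) : MvPolynomial.aeval x nfDen =
    (1 - x 0 * x 1) * (1 + x 0 * x 1 + (x 0 * x 1) ^ 2) := by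
  simp [nfDen]

/-- Auxiliary: `aeval_nfNum`. [folklore] -/
theorem aeval_nfNum (a b c : ℚ) (x : Fin 2 → ℝ) : MvPolynomial.aeval x (nfNum a b c) =
    (a : ℝ) * (1 - x 0 * x 1) * (1 + x 0 * x 1 + (x 0 * x 1) ^ 2) +
      (b : ℝ) * (1 + x 0 * x 1 + (x 0 * x 1) ^ 2) + (c : ℝ) * (1 - x 0 * x 1) := by
  simp [nfNum]

/-- Auxiliary: `nfDen_ne`. [folklore] -/
theorem nfDen_ne (x : Fin 2 → ℝ) (hx : x ∈ box) : MvPolynomial.aeval x nfDen ≠ 0 := by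
  rw [aeval_nfDen]; exact mul_ne_zero (one_sub_t_ne hx) (cubic_ne hx)

/-- Auxiliary: `eqOn_nf`. [folklore] -/
theorem eqOn_nf (a b c : ℚ) :
    EqOn (fun x => MvPolynomial.aeval x (nfNum a b c) / MvPolynomial.aeval x nfDen) (nf a b c) box := by
  intro x hx
  have h1 := one_sub_t_ne hx
  have h2 := cubic_ne hx
  simp only [aeval_nfNum, aeval_nfDen, nf]
  generalize x 0 * x 1 = t at h1 h2 ⊢
  field_simp

/-- The normal-form representation `∫_(0,1)² (a + b/(1−xy) + c/(1+xy+x²y²))` as a `KZ.IntegralRep 2`. -/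
def nfRep (h : RigidityInput I₁ I₂) (a b c : ℚ) : KZ.IntegralRep 2 where
  domain := box
  integrand := nf a b c
  isSemialgebraic_domain := isSemialgebraic_box
  isSemialgebraicFunOn_integrand :=
    (isSemialgebraicFunOn_aeval_div_aeval isSemialgebraic_box (nfNum a b c) nfDen nfDen_ne).congr
      (eqOn_nf a b c)
  integrableOn := integrableOn_nf h a b c

/-- Auxiliary: `nfRep_domain`. [folklore] -/
@[simp] theorem nfRep_domain (h : RigidityInput I₁ I₂) (a b c : ℚ) : (nfRep h a b c).domain = box := rfl

/-- Auxiliary: `nfRep_integrand`. [folklore] -/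
@[simp] theorem nfRep_integrand (h : RigidityInput I₁ I₂) (a b c : ℚ) :
    (nfRep h a b c).integrand = nf a b c := rfl

/-- VALUE of any representation on the box whose integrand is a normal form there. -/
theorem value_of_nf (h : RigidityInput I₁ I₂) (r : KZ.IntegralRep 2) {a b c : ℚ}
    (hdom : r.domain = box) (hint : EqOn r.integrand (nf a b c) box) :
    r.value = a + b * I₁ + c * I₂ := by
  unfold KZ.IntegralRep.value
  rw [hdom, setIntegral_congr_fun measurableSet_box hint, nf_eq_mul]
  have h0 : IntegrableOn (fun _ : Fin 2 → ℝ => (a : ℝ)) box := integrableOn_const volume_box_ne_top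
  have h1 : IntegrableOn (fun x : Fin 2 → ℝ => (b : ℝ) * (1 / (1 - x 0 * x 1))) box :=
    h.int₁.const_mul (b : ℝ)
  have h01 : IntegrableOn (fun x : Fin 2 → ℝ => (a : ℝ) + (b : ℝ) * (1 / (1 - x 0 * x 1))) box :=
    h0.add h1
  have h2 : IntegrableOn (fun x : Fin 2 → ℝ => (c : ℝ) * (1 / (1 + x 0 * x 1 + (x 0 * x 1) ^ 2))) box :=
    h.int₂.const_mul (c : ℝ)
  show ∫ x in box, ((a : ℝ) + (b : ℝ) * (1 / (1 - x 0 * x 1)) +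
      (c : ℝ) * (1 / (1 + x 0 * x 1 + (x 0 * x 1) ^ 2))) = _
  rw [integral_add h01 h2, integral_add h0 h1, integral_const_mul, integral_const_mul,
    h.val₁, h.val₂, setIntegral_const, volume_real_box]
  simp

/-- Auxiliary: `value_nfRep`. [folklore] -/
@[simp] theorem value_nfRep (h : RigidityInput I₁ I₂) (a b c : ℚ) :
    (nfRep h a b c).value = a + b * I₁ + c * I₂ :=
  value_of_nf h _ rfl (fun _ _ => rfl)

/-- RIGIDITY (coefficient comparison): under the inputs, the triple `(a,b,c)` is determined by the
value `a + b I₁ + c I₂`. -/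
theorem coeff_unique (h : RigidityInput I₁ I₂) {a b c a' b' c' : ℚ}
    (he : (a : ℝ) + b * I₁ + c * I₂ = a' + b' * I₁ + c' * I₂) : a = a' ∧ b = b' ∧ c = c' := by
  have hli := Fintype.linearIndependent_iff.mp h.indep ![a - a', b - b', c - c'] (by
    simp [Fin.sum_univ_three, Rat.smul_def]
    linear_combination he)
  have h0 := hli 0
  have h1 := hli 1
  have h2 := hli 2
  simp only [Matrix.cons_val_zero, Matrix.cons_val_one, Matrix.head_cons, Matrix.cons_val_two,
    Matrix.tail_cons, sub_eq_zero] at h0 h1 h2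
  exact ⟨h0, h1, h2⟩

/-- Two normal-form representations on the box that are KZ-equivalent have the same coefficients
(soundness of the calculus + rigidity inputs). This is the ONLY refutation channel available
against `ReductionTwoSix`: evaluation is the only invariant of `KZ.relations` proved in the tree. -/
theorem coeff_eq_of_equivalent (h : RigidityInput I₁ I₂) {a b c a' b' c' : ℚ}
    (r r' : KZ.IntegralRep 2) (hdom : r.domain = box) (hint : EqOn r.integrand (nf a b c) box)
    (hdom' : r'.domain = box) (hint' : EqOn r'.integrand (nf a' b' c') box)
    (heqv : KZ.Equivalent r r') : a = a' ∧ b = b' ∧ c = c' := by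
  have hv : r.value = r'.value := KZ.Equivalent.value_eq_holds heqv
  rw [value_of_nf h r hdom hint, value_of_nf h r' hdom' hint'] at hv
  exact coeff_unique h hv


/-! ## §5 The route's own hypotheses supply the rigidity inputs -/

/-- `BoxIntegralZetaTwo ∧ BoxIntegralLTwoChiThree ∧ CDT Thm 1 ⟹ RigidityInput (π²/6) L(2,χ₋₃)`. -/
theorem rigidityInput_of_route (hζ : BoxIntegralZetaTwo) (hL : BoxIntegralLTwoChiThree)
    (hCDT : LinearIndependent ℚ ![(1 : ℝ), Real.pi ^ 2,
      (∑' n : ℕ, (1 / (3 * (n : ℝ) + 1) ^ 2 - 1 / (3 * (n : ℝ) + 2) ^ 2))]) :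
    RigidityInput (Real.pi ^ 2 / 6)
      (∑' n : ℕ, (1 / (3 * (n : ℝ) + 1) ^ 2 - 1 / (3 * (n : ℝ) + 2) ^ 2)) where
  int₁ := hζ.1
  val₁ := hζ.2
  int₂ := hL.1
  val₂ := hL.2
  indep := by
    rw [Fintype.linearIndependent_iff] at hCDT ⊢
    intro g hg i
    have key := hCDT ![g 0, g 1 / 6, g 2] (by
      simp only [Fin.sum_univ_three, Matrix.cons_val_zero, Matrix.cons_val_one, Matrix.head_cons,
        Matrix.cons_val_two, Matrix.tail_cons, Rat.smul_def] at hg ⊢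
      push_cast
      linear_combination hg)
    fin_cases i
    · simpa using key 0
    · have := key 1
      simp at this
      simpa using this
    · simpa using key 2


end

end Summit.KontsevichZagierPeriods.HurwitzMicroSectors.ReductionTwoSixNegative
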